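import Literature.NumberTheory.Transcendental.LogLatticeEngine
import HarnessLib

/-!
# Rigidity of plane curves through `u + 2πi ℚ²`: slicing the identity `G(u + cV) = μ S(V)`

Continuation of `Literature.NumberTheory.Transcendental.LogLatticeEngine` (see there for the
overall argument and notation: `c = 2πi`, `G ∈ ℚ̄[X₀, X₁]`, `S ∈ ℚ[V₀, V₁]`, the identity
`G(u + cV) = μ S(V)` written `bind₁ (Xᵢ ↦ uᵢ + c Xᵢ) G = C μ * S`). Writing `G` as a polynomial in
`X₀` whose coefficients are polynomials in `X₁` ("slices",
`Literature.Algebra.Polynomial.finTwoSlice_bind₁_affine`) we prove: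

* `eq_C_mul_X_pow_of_bind₁_affine_eq` — the **normalised case** `u = (0, a)` with `(a, c)`
  `ℚ`-independent: then `G = γ X₀^J`;
* `false_of_bind₁_affine_eq_of_forall` — the **rank-three case**: if `(u₀, u₁, c)` admit no
  relation `p u₀ + q u₁ ∈ ℚ c` with `(p, q) ≠ 0`, the identity is impossible as soon as `G`
  involves `X₀`.

Only Hermite–Lindemann and the transcendence of `π` are used (through the engine).
-/

noncomputable section

open Polynomial Complex
open Literature.Algebra.Polynomial

namespace Literature.NumberTheory.Transcendental.LogLattice

/-! ### Slicing the identity `G(u + cV) = μ S(V)` -/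

/-- Iterated coefficients of a sliced polynomial with algebraic coefficients are algebraic.
[folklore] -/
theorem isAlgebraic_coeff_coeff_slice {G : MvPolynomial (Fin 2) ℂ}
    (hG : ∀ m, IsAlgebraic ℚ (G.coeff m)) (j n : ℕ) :
    IsAlgebraic ℚ (((((MvPolynomial.finSuccEquiv ℂ 1).trans
      (Polynomial.mapAlgEquiv (MvPolynomial.uniqueAlgEquiv ℂ (Fin 1)))) G).coeff j).coeff n) := by
  rw [coeff_coeff_finTwoSlice]
  exact hG _

/-- Iterated coefficients of a sliced polynomial with rational coefficients are rational.
[folklore] -/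
theorem exists_rat_coeff_coeff_slice {S : MvPolynomial (Fin 2) ℂ}
    (hS : ∀ m, ∃ q : ℚ, S.coeff m = q) (j n : ℕ) :
    ∃ q : ℚ, ((((MvPolynomial.finSuccEquiv ℂ 1).trans
      (Polynomial.mapAlgEquiv (MvPolynomial.uniqueAlgEquiv ℂ (Fin 1)))) S).coeff j).coeff n = q := by
  rw [coeff_coeff_finTwoSlice]
  exact hS _

/-- From `C g * C x = C μ * q` (constants `g, x`, a polynomial `q`) read off `g x = μ q₀`.
[folklore] -/
theorem coeff_zero_of_C_mul_C_eq {g x μ : ℂ} {q : ℂ[X]} (h : C g * C x = C μ * q) :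
    g * x = μ * q.coeff 0 := by
  have := congrArg (fun p : ℂ[X] => p.coeff 0) h
  simpa [coeff_C_mul, coeff_C] using this

/-- `compRingHom (C a + C c * X)` is injective for `c ≠ 0`. [folklore] -/
theorem comp_affine_injective {a c : ℂ} (hc : c ≠ 0) :
    Function.Injective (Polynomial.compRingHom (C a + C c * X) : ℂ[X] → ℂ[X]) := by
  intro p q hpq
  rw [← sub_eq_zero] at hpq ⊢
  have h : (p - q).comp (C a + C c * X) = 0 := by
    rw [sub_comp]
    simpa [Polynomial.coe_compRingHom_apply] using hpq
  rcases (comp_eq_zero_iff).1 h with h0 | ⟨-, h1⟩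
  · exact h0
  · exfalso
    have := congrArg (fun r : ℂ[X] => r.coeff 1) h1
    simp [coeff_C, hc] at this

/-- **Normalised case.** If `G(c V₀, a + c V₁) = μ · S(V)` (`c = 2πi`; outer shift `0`, inner
shift `a` with `e^a` algebraic and `(a, c)` independent), `G ≠ 0` with algebraic coefficients and
`S` rational, then `G = γ X₀^J`: every slice `G_m(a + cT) = μ c^{-m} S_m(T)` is constant by the
engine, and two non-zero constant slices in degrees `m < J` would make `c^{J-m}` algebraic.
[cite: Lindemann1882] -/
theorem eq_C_mul_X_pow_of_bind₁_affine_eq {a μ : ℂ} (ha : IsAlgebraic ℚ (exp a))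
    (hind : ∀ q r : ℚ, (q : ℂ) * a + r * (2 * (Real.pi : ℂ) * I) = 0 → q = 0)
    (G S : MvPolynomial (Fin 2) ℂ) (hG : ∀ m, IsAlgebraic ℚ (G.coeff m))
    (hS : ∀ m, ∃ q : ℚ, S.coeff m = q) (hG0 : G ≠ 0)
    (h : MvPolynomial.bind₁ (fun i => MvPolynomial.C ((![0, a] : Fin 2 → ℂ) i) +
        MvPolynomial.C (2 * (Real.pi : ℂ) * I) * MvPolynomial.X i) G = MvPolynomial.C μ * S) :
    ∃ (γ : ℂ) (J : ℕ), γ ≠ 0 ∧ IsAlgebraic ℚ γ ∧ G = MvPolynomial.C γ * MvPolynomial.X 0 ^ J := by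
  set c : ℂ := 2 * (Real.pi : ℂ) * I with hc
  clear_value c
  have hc0 : c ≠ 0 := hc ▸ Complex.two_pi_I_ne_zero
  set P := ((MvPolynomial.finSuccEquiv ℂ 1).trans
      (Polynomial.mapAlgEquiv (MvPolynomial.uniqueAlgEquiv ℂ (Fin 1)))) G with hP
  set Q := ((MvPolynomial.finSuccEquiv ℂ 1).trans
      (Polynomial.mapAlgEquiv (MvPolynomial.uniqueAlgEquiv ℂ (Fin 1)))) S with hQ
  have hP0 : P ≠ 0 := by
    rw [hP]
    exact (EmbeddingLike.map_ne_zero_iff).2 hG0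
  have hPalg : ∀ j n, IsAlgebraic ℚ ((P.coeff j).coeff n) := fun j n =>
    isAlgebraic_coeff_coeff_slice hG j n
  have hQrat : ∀ j n, ∃ q : ℚ, (Q.coeff j).coeff n = q := fun j n =>
    exists_rat_coeff_coeff_slice hS j n
  set ℓ : ℂ[X] := C a + C c * X with hℓ
  -- the sliced identity
  have hslice : (P.map (Polynomial.compRingHom ℓ)).comp (C (C c) * X) = C (C μ) * Q := by
    have := congrArg ((MvPolynomial.finSuccEquiv ℂ 1).trans
      (Polynomial.mapAlgEquiv (MvPolynomial.uniqueAlgEquiv ℂ (Fin 1)))) h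
    rw [finTwoSlice_bind₁_affine, map_mul, finTwoSlice_C] at this
    simpa only [Matrix.cons_val_zero, Matrix.cons_val_one, Matrix.head_cons, map_zero,
      zero_add] using this
  -- coefficientwise
  have hcoef : ∀ m, (P.coeff m).comp ℓ * C (c ^ m) = C μ * Q.coeff m := by
    intro m
    have hm : ((P.map (Polynomial.compRingHom ℓ)).comp (C (C c) * X)).coeff m =
        (C (C μ) * Q).coeff m := by rw [hslice]
    rw [coeff_comp_C_mul_X, Polynomial.coeff_map, Polynomial.coe_compRingHom_apply,
      coeff_C_mul, ← C_pow] at hm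
    exact hm
  have hcoef' : ∀ m, (P.coeff m).comp ℓ = C (μ * (c ^ m)⁻¹) * Q.coeff m := by
    intro m
    have hcm : c ^ m ≠ 0 := pow_ne_zero _ hc0
    calc (P.coeff m).comp ℓ = (P.coeff m).comp ℓ * C (c ^ m) * C ((c ^ m)⁻¹) := by
          rw [mul_assoc _ (C (c ^ m)) _, ← C_mul, mul_inv_cancel₀ hcm, C_1, mul_one]
      _ = C μ * Q.coeff m * C ((c ^ m)⁻¹) := by rw [hcoef]
      _ = C (μ * (c ^ m)⁻¹) * Q.coeff m := by rw [C_mul]; ring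
  -- constant slices: `g_m c^m = μ q_m` whenever `P_m` is the constant `g_m`
  have hval : ∀ m, (P.coeff m).natDegree = 0 →
      (P.coeff m).coeff 0 * c ^ m = μ * (Q.coeff m).coeff 0 := by
    intro m hm0
    have := hcoef m
    rw [eq_C_of_natDegree_eq_zero hm0, C_comp] at this
    exact coeff_zero_of_C_mul_C_eq this
  -- from here on use the literal value of `c`
  subst hc
  -- every slice is constant
  have hconst : ∀ m, (P.coeff m).natDegree = 0 := fun m =>
    natDegree_eq_zero_of_comp_affine_eq ha hind (P.coeff m) (hPalg m) (Q.coeff m) (hQrat m)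
      (hcoef' m)
  have hC : ∀ m, P.coeff m = C ((P.coeff m).coeff 0) := fun m =>
    eq_C_of_natDegree_eq_zero (hconst m)
  set J := P.natDegree with hJ
  set γ : ℂ := (P.coeff J).coeff 0 with hγ
  have hγ0 : γ ≠ 0 := by
    intro h0
    have hlead : P.coeff J ≠ 0 := mt leadingCoeff_eq_zero.1 hP0
    apply hlead
    rw [hC J, ← hγ, h0, C_0]
  -- all slices except the top one vanish
  have hvan : ∀ m, m ≠ J → P.coeff m = 0 := by
    intro m hm
    rcases lt_or_gt_of_ne hm with hlt | hgt
    · by_contra hne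
      set g : ℂ := (P.coeff m).coeff 0 with hg
      have hg0 : g ≠ 0 := fun h0 => hne (by rw [hC m, ← hg, h0, C_0])
      obtain ⟨qm, hqm⟩ := hQrat m 0
      obtain ⟨qJ, hqJ⟩ := hQrat J 0
      have e1 : g * (2 * (Real.pi : ℂ) * I) ^ m = μ * qm := by rw [hg, hval m (hconst m), hqm]
      have e2 : γ * (2 * (Real.pi : ℂ) * I) ^ J = μ * qJ := by rw [hγ, hval J (hconst J), hqJ]
      have hqm0 : (qm : ℂ) ≠ 0 := by
        intro h0
        rw [h0, mul_zero] at e1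
        exact mul_ne_zero hg0 (pow_ne_zero _ hc0) e1
      -- `(γ qm) c^{J-m} = g qJ`
      have e3 : γ * qm * (2 * (Real.pi : ℂ) * I) ^ (J - m) = g * qJ := by
        have hcm : (2 * (Real.pi : ℂ) * I) ^ m ≠ 0 := pow_ne_zero _ hc0
        apply mul_right_cancel₀ hcm
        calc γ * qm * (2 * (Real.pi : ℂ) * I) ^ (J - m) * (2 * (Real.pi : ℂ) * I) ^ m
            = γ * (2 * (Real.pi : ℂ) * I) ^ J * qm := by
              rw [mul_assoc, ← pow_add, Nat.sub_add_cancel hlt.le]; ring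
          _ = μ * qJ * qm := by rw [e2]
          _ = μ * qm * qJ := by ring
          _ = g * (2 * (Real.pi : ℂ) * I) ^ m * qJ := by rw [e1]
          _ = g * qJ * (2 * (Real.pi : ℂ) * I) ^ m := by ring
      exact false_of_mul_twoPiI_pow_eq ((hPalg J 0).mul (isAlgebraic_rat ℚ qm))
        ((hPalg m 0).mul (isAlgebraic_rat ℚ qJ)) (mul_ne_zero hγ0 hqm0)
        (Nat.sub_ne_zero_of_lt hlt) e3
    · exact coeff_eq_zero_of_natDegree_lt hgt
  refine ⟨γ, J, hγ0, hPalg J 0, eq_C_mul_X_pow_of_finTwoSlice_eq G γ J ?_⟩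
  rw [← hP]
  ext m : 1
  rw [coeff_C_mul_X_pow]
  split_ifs with hm
  · rw [hm, hC J]
  · exact hvan m hm

/-- **The rank-three case is impossible.** If `G(u + cV) = μ S(V)` with `G ≠ 0` algebraic of
positive `X₀`-degree, `S` rational, `e^{u₀}, e^{u₁}` algebraic and **no** non-trivial relation
`p u₀ + q u₁ ∈ ℚ c` (`(p, q) ≠ 0`), contradiction: the top slice is a constant `γ`, the next
slice `G_e` satisfies `G_e(u₁ + cT) + (e+1) u₀ γ = (γ c/σ) S_e(T)`, so has degree `≤ 1`, and its
two coefficients give an algebraic number equal to `(s₀/σ) c - (e+1) u₀ - (s₁/σ) u₁`, which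
Hermite–Lindemann forces to vanish — a forbidden relation. [cite: Lindemann1882] -/
theorem false_of_bind₁_affine_eq_of_forall {u : Fin 2 → ℂ} {μ : ℂ}
    (hu : ∀ j, IsAlgebraic ℚ (exp (u j)))
    (hB : ∀ p q r : ℚ, (p : ℂ) * u 0 + q * u 1 = r * (2 * (Real.pi : ℂ) * I) → p = 0 ∧ q = 0)
    (G S : MvPolynomial (Fin 2) ℂ) (hG : ∀ m, IsAlgebraic ℚ (G.coeff m))
    (hS : ∀ m, ∃ q : ℚ, S.coeff m = q)
    (h : MvPolynomial.bind₁ (fun i => MvPolynomial.C (u i) +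
        MvPolynomial.C (2 * (Real.pi : ℂ) * I) * MvPolynomial.X i) G = MvPolynomial.C μ * S)
    (hJ : (((MvPolynomial.finSuccEquiv ℂ 1).trans
      (Polynomial.mapAlgEquiv (MvPolynomial.uniqueAlgEquiv ℂ (Fin 1)))) G).natDegree ≠ 0) :
    False := by
  set c : ℂ := 2 * (Real.pi : ℂ) * I with hc
  clear_value c
  have hc0 : c ≠ 0 := hc ▸ Complex.two_pi_I_ne_zero
  have hind1 : ∀ q r : ℚ, (q : ℂ) * u 1 + r * c = 0 → q = 0 := by
    intro q r hqr
    have := hB 0 q (-r) (by push_cast; linear_combination hqr)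
    exact this.2
  set P := ((MvPolynomial.finSuccEquiv ℂ 1).trans
      (Polynomial.mapAlgEquiv (MvPolynomial.uniqueAlgEquiv ℂ (Fin 1)))) G with hP
  set Q := ((MvPolynomial.finSuccEquiv ℂ 1).trans
      (Polynomial.mapAlgEquiv (MvPolynomial.uniqueAlgEquiv ℂ (Fin 1)))) S with hQ
  have hPalg : ∀ j n, IsAlgebraic ℚ ((P.coeff j).coeff n) := fun j n =>
    isAlgebraic_coeff_coeff_slice hG j n
  have hQrat : ∀ j n, ∃ q : ℚ, (Q.coeff j).coeff n = q := fun j n =>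
    exists_rat_coeff_coeff_slice hS j n
  set ℓ : ℂ[X] := C (u 1) + C c * X with hℓ
  set Pθ := P.map (Polynomial.compRingHom ℓ) with hPθ
  have hinj := comp_affine_injective (a := u 1) hc0
  have hdeg : Pθ.natDegree = P.natDegree := natDegree_map_eq_of_injective hinj P
  have hcoefθ : ∀ m, Pθ.coeff m = (P.coeff m).comp ℓ := fun m => by
    rw [hPθ, Polynomial.coeff_map, Polynomial.coe_compRingHom_apply]
  obtain ⟨e, he⟩ := Nat.exists_eq_succ_of_ne_zero hJ
  have he' : P.natDegree = e + 1 := he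
  have heθ : Pθ.natDegree = e + 1 := hdeg.trans he'
  -- the sliced identity
  have hslice : Pθ.comp (C (C (u 0)) + C (C c) * X) = C (C μ) * Q := by
    have := congrArg ((MvPolynomial.finSuccEquiv ℂ 1).trans
      (Polynomial.mapAlgEquiv (MvPolynomial.uniqueAlgEquiv ℂ (Fin 1)))) h
    rw [finTwoSlice_bind₁_affine, map_mul, finTwoSlice_C] at this
    exact this
  -- top slice
  have htop : (P.coeff (e + 1)).comp ℓ * C (c ^ (e + 1)) = C μ * Q.coeff (e + 1) := by
    have hm : (Pθ.comp (C (C (u 0)) + C (C c) * X)).coeff (e + 1) =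
        (C (C μ) * Q).coeff (e + 1) := by rw [hslice]
    rw [← heθ, coeff_comp_affine_natDegree, heθ, hcoefθ, coeff_C_mul, ← C_pow] at hm
    exact hm
  have hce1 : c ^ (e + 1) ≠ 0 := pow_ne_zero _ hc0
  have htop' : (P.coeff (e + 1)).comp ℓ = C (μ * (c ^ (e + 1))⁻¹) * Q.coeff (e + 1) := by
    calc (P.coeff (e + 1)).comp ℓ
        = (P.coeff (e + 1)).comp ℓ * C (c ^ (e + 1)) * C ((c ^ (e + 1))⁻¹) := by
          rw [mul_assoc _ (C (c ^ (e + 1))) _, ← C_mul, mul_inv_cancel₀ hce1, C_1, mul_one]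
      _ = C μ * Q.coeff (e + 1) * C ((c ^ (e + 1))⁻¹) := by rw [htop]
      _ = C (μ * (c ^ (e + 1))⁻¹) * Q.coeff (e + 1) := by rw [C_mul]; ring
  -- second slice
  have hsec : ∀ γ : ℂ, P.coeff (e + 1) = C γ →
      ((P.coeff e).comp ℓ + C (((e + 1 : ℕ) : ℂ) * u 0 * γ)) * C (c ^ e) = C μ * Q.coeff e := by
    intro γ hγC
    have hm : (Pθ.comp (C (C (u 0)) + C (C c) * X)).coeff e = (C (C μ) * Q).coeff e := by
      rw [hslice]
    rw [coeff_comp_affine_of_natDegree_eq_succ Pθ _ _ heθ, hcoefθ, hcoefθ, hγC, C_comp,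
      coeff_C_mul, ← C_pow] at hm
    rw [← hm]
    congr 1
    rw [← C_eq_natCast, ← C_mul, ← C_mul]
  have hce : c ^ e ≠ 0 := pow_ne_zero _ hc0
  have hsec' : ∀ γ : ℂ, P.coeff (e + 1) = C γ →
      (P.coeff e).comp ℓ + C (((e + 1 : ℕ) : ℂ) * u 0 * γ) = C (μ * (c ^ e)⁻¹) * Q.coeff e := by
    intro γ hγC
    calc (P.coeff e).comp ℓ + C (((e + 1 : ℕ) : ℂ) * u 0 * γ)
        = ((P.coeff e).comp ℓ + C (((e + 1 : ℕ) : ℂ) * u 0 * γ)) * C (c ^ e) * C ((c ^ e)⁻¹) := by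
          rw [mul_assoc _ (C (c ^ e)) _, ← C_mul, mul_inv_cancel₀ hce, C_1, mul_one]
      _ = C μ * Q.coeff e * C ((c ^ e)⁻¹) := by rw [hsec γ hγC]
      _ = C (μ * (c ^ e)⁻¹) * Q.coeff e := by rw [C_mul]; ring
  -- from here on use the literal value of `c`
  subst hc
  have hconst : (P.coeff (e + 1)).natDegree = 0 :=
    natDegree_eq_zero_of_comp_affine_eq (hu 1) hind1 _ (hPalg _) _ (hQrat _) htop'
  set γ : ℂ := (P.coeff (e + 1)).coeff 0 with hγ
  have hγC : P.coeff (e + 1) = C γ := eq_C_of_natDegree_eq_zero hconst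
  have hP0 : P ≠ 0 := by
    intro h0
    rw [h0, natDegree_zero] at he'
    exact Nat.succ_ne_zero e he'.symm
  have hγ0 : γ ≠ 0 := by
    intro h0
    have hlead : P.coeff (e + 1) ≠ 0 := by
      rw [← he']
      exact mt leadingCoeff_eq_zero.1 hP0
    exact hlead (by rw [hγC, h0, C_0])
  obtain ⟨σ, hσ⟩ := hQrat (e + 1) 0
  have eμ : γ * (2 * (Real.pi : ℂ) * I) ^ (e + 1) = μ * σ := by
    have := htop
    rw [hγC, C_comp] at this
    rw [← hσ]
    exact coeff_zero_of_C_mul_C_eq this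
  have hce1' : (2 * (Real.pi : ℂ) * I) ^ (e + 1) ≠ 0 := pow_ne_zero _ Complex.two_pi_I_ne_zero
  have hσ0 : (σ : ℂ) ≠ 0 := by
    intro h0
    rw [h0, mul_zero] at eμ
    exact mul_ne_zero hγ0 hce1' eμ
  have hdeg1 : (P.coeff e).natDegree ≤ 1 :=
    natDegree_le_one_of_comp_affine_add_C_eq (hu 1) hind1 _ (hPalg _) _ (hQrat _) (hsec' γ hγC)
  -- write `P_e = C g₁ * X + C g₀` and compare the two coefficients
  set g₁ : ℂ := (P.coeff e).coeff 1 with hg₁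
  set g₀ : ℂ := (P.coeff e).coeff 0 with hg₀
  have hPe : P.coeff e = C g₁ * X + C g₀ := eq_X_add_C_of_natDegree_le_one hdeg1
  obtain ⟨s₁, hs₁⟩ := hQrat e 1
  obtain ⟨s₀, hs₀⟩ := hQrat e 0
  have hident := hsec' γ hγC
  have hexp : (C g₁ * X + C g₀ : ℂ[X]).comp (C (u 1) + C (2 * (Real.pi : ℂ) * I) * X) +
      C (((e + 1 : ℕ) : ℂ) * u 0 * γ) =
      C (g₁ * (2 * (Real.pi : ℂ) * I)) * X +
        C (g₁ * u 1 + g₀ + ((e + 1 : ℕ) : ℂ) * u 0 * γ) := by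
    simp only [add_comp, mul_comp, C_comp, X_comp, C_mul, C_add]
    ring
  rw [hPe, hexp] at hident
  have e1 : g₁ * (2 * (Real.pi : ℂ) * I) = μ * ((2 * (Real.pi : ℂ) * I) ^ e)⁻¹ * s₁ := by
    have := congrArg (fun p : ℂ[X] => p.coeff 1) hident
    simp only [coeff_add, coeff_C_mul, coeff_X_one, coeff_C, if_neg one_ne_zero, mul_one,
      add_zero] at this
    rw [this, hs₁]
  have e0 : g₁ * u 1 + g₀ + ((e + 1 : ℕ) : ℂ) * u 0 * γ =
      μ * ((2 * (Real.pi : ℂ) * I) ^ e)⁻¹ * s₀ := by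
    have := congrArg (fun p : ℂ[X] => p.coeff 0) hident
    simp only [coeff_add, coeff_C_mul, coeff_X_zero, coeff_C_zero, mul_zero,
      zero_add] at this
    rw [this, hs₀]
  -- solve for `μ c^{-e}`, `g₁`, `g₀`
  set c : ℂ := 2 * (Real.pi : ℂ) * I with hc
  clear_value c
  have hce : c ^ e ≠ 0 := pow_ne_zero _ (hc ▸ Complex.two_pi_I_ne_zero)
  have hc0' : c ≠ 0 := hc ▸ Complex.two_pi_I_ne_zero
  have hμ' : μ * (c ^ e)⁻¹ = γ * c * (σ : ℂ)⁻¹ := by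
    rw [pow_succ] at eμ
    field_simp
    linear_combination -eμ
  have hg₁' : g₁ = γ * s₁ * (σ : ℂ)⁻¹ := by
    rw [hμ'] at e1
    field_simp at e1
    field_simp
    linear_combination e1
  have hg₀' : g₀ = γ * (c * s₀ * (σ : ℂ)⁻¹ - s₁ * (σ : ℂ)⁻¹ * u 1 - ((e + 1 : ℕ) : ℂ) * u 0) := by
    rw [hμ', hg₁'] at e0
    field_simp at e0
    field_simp
    linear_combination e0
  -- the algebraic number `β = g₀ / γ`
  set β : ℂ := g₀ * γ⁻¹ with hβ
  have hβalg : IsAlgebraic ℚ β := (hPalg e 0).mul (hPalg (e + 1) 0).inv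
  have hβeq : β = ((s₀ / σ : ℚ) : ℂ) * c + ((-(e + 1 : ℕ) : ℚ) : ℂ) * u 0 +
      ((-(s₁ / σ) : ℚ) : ℂ) * u 1 := by
    rw [hβ, hg₀']
    push_cast
    field_simp
    ring
  subst hc
  have hβ0 : β = 0 := eq_zero_of_isAlgebraic_of_eq_combination hβalg (hu 0) (hu 1) _ _ _ hβeq
  have hrel : (((e + 1 : ℕ) : ℚ) : ℂ) * u 0 + ((s₁ / σ : ℚ) : ℂ) * u 1 =
      ((s₀ / σ : ℚ) : ℂ) * (2 * (Real.pi : ℂ) * I) := by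
    rw [hβ0] at hβeq
    push_cast at hβeq ⊢
    linear_combination hβeq
  have := (hB _ _ _ hrel).1
  exact Nat.succ_ne_zero e (by exact_mod_cast this)

end Literature.NumberTheory.Transcendental.LogLattice
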